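import Summits.QuantumFields.YangMills.Theorems.UnitScaleTiltFluctuationComparisonRegPrGlobalSlackLegCfgDistT3Window
import Summits.QuantumFields.YangMills.Theorems.UnitScaleTiltFluctuationComparisonRegPrGlobalSlackKernelLegDisplayProfileLow
import HarnessLib

/-!
# `UnitScaleTiltFluctuationComparisonRegPrGlobalSlackLegCfgDistNaturalT3` — THE I-11 ROW (44) `CfgDistΦ` HOLDS FOR THE NATURAL CONFIGURATION FAMILY `B♮` (crux
# `FluctuationComparisonRegPrIntL`, stmt-QuantumFields-20520, skeletons v5kC / v5kD, STUB 3⁗χ; cell `pub/ym-inputs`, seat ym-inputs-p11 = INPUT-LIST I-11 row `CfgDistΦ`;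
# count-neutral helper, def-free, registry untouched)

WHY.  The leg-currency sockets of 3⁗χ (`K1aLegRowsRChi`, the door display `K1aLegRowsDisplayChiAtLow`) ask for ONE configuration family `B : CfgFam 𝔤ᶜ F` as an EXISTENTIAL carrying
(N) `NewLevelIsBirth` (on the new level `B` is the birth configuration `Bcfg`), (R4-low) `CfgDistOwnΦLow` (print's (44) below the new level) and (R5) `CfgRefOwnΦ`; (R4) `CfgDistOwnΦ`
and the two-run row `CfgDistΦ` follow (`cfgDistOwnΦ_chi_of_low_of_newLevelIsBirth`, `cfgDistΦ_of_own`).  No file exhibited such a `B`.  Print NAMES it ((43) p.266: «B_k(c) = (1/i) log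
Ū_k^j(Γ_{y,c₋} ∪ c ∪ Γ_{c₊,y})», the (27)-loop variables of the `j`-fold average of the minimiser, anchored at the block `y`), and `…LegCfgDistT3(Window)` proved its (44) bound in the
row's currency.  This file WRITES THE FAMILY DOWN (inline, no `def`) and proves its rows:

  `B♮ K k b Y W c := if b + 1 = k then birthCfgAt q K b Y W c` (the new level: the birth configuration of `…KernelLegBirth`)
  `               else if |c₋ − y(Y)|₁·2B₃θ_{b₀,p₁}(K−k)·(L^{k−b})⁻² ≤ ½ then P_{𝔤ᶜ}(vec((1/i) log Ū^b(U_k(triv,W))(Γ_{y(Y),c₋} ∪ c ∪ Γ_{c₊,y(Y)})))` (print's regime)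
  `               else 0` (the far legs, where print never evaluates (44): localisation of `𝒫_j`, p.263 L4),
with `q = toCore ∘ p`, `y(Y) = (anchors_nonempty K b Y).choose` an anchor of `Y`, `U_k(triv,·) = (p K).UkH k triv` the r1 minimiser, `Ū^b` the `b`-fold `ℰp`-average, `vec` the
vectorisation `vecE` into the Frobenius carrier and `P_{𝔤ᶜ}` the orthogonal projection onto `lieC (suGroupModel 2)` (the identity on `𝔰𝔩(2,ℂ) ∋ (1/i) log SU(2)`; used so that no
membership lemma is needed for the bound).

* §1 `norm_vecE_sq`, **`norm_vecE_le`** (`‖vecE X‖ ≤ √N·‖X‖_op`, from `MatrixNorms.sum_norm_sq_col_le_opNorm_sq`), `norm_vecE_two_le`, `norm_proj_vecE_two_le` (`‖P_{𝔤ᶜ}(vec X)‖ ≤ 2‖X‖_op`).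
* §2 `exists_blockSet_of_mem_canonLocCore` — below the new level the listed domains of `canonLocCore` are single blocks `blockSet K i y`.
* §3 **`natural_newLevel_eq_bcfg`**, **`newLevelIsBirth_natural`** — (N) holds for the canonical triple `(birthChartCore q, 0, B♮)`; **`cfgDistOwnΦLow_chi_natural`** — (R4-low) for `B♮` at
  the χ-datum, ANY profile `p₁`, constant `24·L·B₃`, under the window letters `hθ` («every `θ_{b₀,p₁}(n)`, `n < K`, lies in r1's range `θ ≤ a₁`, `B₃θ ≤ a₀` and inside [B7] Prop. 2's two
  smallness letters» — what the display's `∃ γB` is for); **`cfgDistOwnΦ_chi_natural`** — (R4) at every `p₁ ≥ p₀ + r₀`, constant `max (24LB₃) (cB·(√L)⁻¹(1+log √L)^{p₁})`;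
  ★ **`cfgDistΦ_chi_natural`** — THE I-11 ROW `CfgDistΦ (dataOfV3chi p (canonPolymerCore (toCore ∘ p))) B♮ (canonLegDist F) 𝔠.b₀ p₁ (…)` for both runs.

HONEST SCOPE.  (i) This discharges `CfgDistΦ` / (R4) / (N)'s configuration clause FOR `B♮`; the display's remaining rows for the SAME triple — (M1) `OldTermsAreJetsOwn` (the package's
`oldVal` ARE the jets of a chart family at `B♮`: print's (33)–(34)/(43) re-localisation, the real content), (R5) `CfgRefOwnΦ` (ym-inputs-p12's fixed-point reduction ✓p618658), (R1),
(R2′) — are NOT touched, and whether the (α)-record desk adopts `B♮` (axial anchor ∈ `anchors`, Frobenius carrier, far-leg cut-off at print's regime) is its call: every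
convention is visible in the statement.  (ii) The window letters `hθ` are hypotheses (`K`-uniform smallness of `θ_{b₀,p₁}`), not discharged here.  (iii) Nothing of [Balaban1985UV3] /
[Balaban1985Variational] / [Balaban1985Averaging] is asserted beyond the cited tree theorems; no summit / rung / gap claim (YM₃ on T³ is ladder rung R3, not the Clay problem).

References: T. Bałaban, CMP 102 (1985) 255–275 [Balaban1985UV3] ((27)–(28) p.263, p.263 L4, (33)–(34) p.264, (43)–(44) pp.266–267, (60)–(61) p.271); CMP 102 (1985) 277–309
[Balaban1985Variational] ((2) p.278, Thm 1 (8) p.279); CMP 98 (1985) 17–51 [Balaban1985Averaging] (Prop. 2 (52)–(54) p.26); CMP 109 (1987) 249–301 [Balaban1987RG1] ((0.1) p.251).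
-/

set_option autoImplicit false

noncomputable section

open scoped Matrix.Norms.L2Operator
open Literature.MathematicalPhysics.QuantumFieldTheory.Balaban1983to89
open Literature.MathematicalPhysics.QuantumFieldTheory.Balaban1983to89.T3ContinuumYM3Torus
open Literature.MathematicalPhysics.QuantumFieldTheory.Balaban1983to89.T3UnitLawDensityEML (ℰp)
open Literature.MathematicalPhysics.QuantumFieldTheory.Balaban1983to89.T3UnitScaleTilt (θBal)
open Literature.MathematicalPhysics.QuantumFieldTheory.Balaban1983to89.T3LevelShift (fieldShift)
open Literature.MathematicalPhysics.QuantumFieldTheory.Balaban1983to89.T3AlphaPolymerSocket (refineSet)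
open Literature.MathematicalPhysics.QuantumFieldTheory.Balaban1983to89.TreeLengthTorus (tsys)
open Literature.MathematicalPhysics.QuantumFieldTheory.Balaban1983to89.B10Eq27TorusAxialLog
open Literature.MathematicalPhysics.QuantumFieldTheory.Balaban1983to89.B7Prop1Explicit (l1)
open Literature.MathematicalPhysics.QuantumFieldTheory.Balaban1983to89.ExpMeanLog (deltaSU)
open Literature.MathematicalPhysics.QuantumFieldTheory.Balaban1983to89.MatrixNorms (sum_norm_sq_col_le_opNorm_sq)
open Literature.MathematicalPhysics.QuantumFieldTheory.Balaban1985CMP102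
open Literature.MathematicalPhysics.QuantumFieldTheory.Balaban1985CMP102.Setting
open Summit.QuantumFields.Balaban3D.Carriers
open Summit.QuantumFields.Balaban3D.Proofs.Primitives
open Summit.QuantumFields.Balaban3D.Proofs.GroupModelLieC (vecE vecE_apply lieC)
open Summit.QuantumFields.YangMills.Theorems
open Summit.QuantumFields.YangMills.Theorems.GlobalSlackCanonicalPolymers

namespace Summit.QuantumFields.YangMills.Theorems.GlobalSlackKernelLeg

/-! ## §1 The Frobenius carrier: `‖vecE X‖ ≤ √N·‖X‖_op`, so the `𝔤ᶜ`-projection of a `2×2` matrix is at most twice its operator norm -/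

section VecE

/-- `‖vecE X‖² = Σ_{j,i} |X_{ij}|²` (the Euclidean norm of the vectorisation is the Frobenius norm). [folklore] -/
theorem norm_vecE_sq {N : ℕ} (X : Matrix (Fin N) (Fin N) ℂ) : ‖vecE N X‖ ^ 2 = ∑ j, ∑ i, ‖X i j‖ ^ 2 := by
  rw [EuclideanSpace.norm_sq_eq, Fintype.sum_prod_type, Finset.sum_comm]
  rfl

/-- **Frobenius against operator norm**: `‖vecE X‖ ≤ √N·‖X‖` (column by column, `MatrixNorms.sum_norm_sq_col_le_opNorm_sq`). [folklore] -/
theorem norm_vecE_le {N : ℕ} (X : Matrix (Fin N) (Fin N) ℂ) : ‖vecE N X‖ ≤ Real.sqrt N * ‖X‖ := by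
  have hsq : ‖vecE N X‖ ^ 2 ≤ (N : ℝ) * ‖X‖ ^ 2 := by
    rw [norm_vecE_sq]
    calc ∑ j : Fin N, ∑ i, ‖X i j‖ ^ 2 ≤ ∑ _j : Fin N, ‖X‖ ^ 2 := Finset.sum_le_sum fun j _ => sum_norm_sq_col_le_opNorm_sq X j
      _ = (N : ℝ) * ‖X‖ ^ 2 := by rw [Finset.sum_const, Finset.card_univ, Fintype.card_fin]; ring
  have h0 : 0 ≤ Real.sqrt N * ‖X‖ := by positivity
  have h1 : (Real.sqrt N * ‖X‖) ^ 2 = (N : ℝ) * ‖X‖ ^ 2 := by rw [mul_pow, Real.sq_sqrt (Nat.cast_nonneg N)]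
  exact le_of_pow_le_pow_left₀ two_ne_zero h0 (by rw [h1]; exact hsq)

/-- For `N = 2`: `‖vecE X‖ ≤ 2‖X‖` (`√2 ≤ 2`). [folklore] -/
theorem norm_vecE_two_le (X : Matrix (Fin 2) (Fin 2) ℂ) : ‖vecE 2 X‖ ≤ 2 * ‖X‖ := by
  refine (norm_vecE_le X).trans (mul_le_mul_of_nonneg_right ?_ (norm_nonneg _))
  rw [show ((2 : ℕ) : ℝ) = 2 by norm_num]
  have h := Real.sqrt_le_sqrt (show (2 : ℝ) ≤ 4 by norm_num)
  rwa [show (4 : ℝ) = 2 ^ 2 by norm_num, Real.sqrt_sq (by norm_num : (0:ℝ) ≤ 2)] at h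

/-- The `𝔤ᶜ`-projection of a vectorised `2×2` matrix is at most twice its operator norm (`‖P_K v‖ ≤ ‖v‖`). [folklore] -/
theorem norm_proj_vecE_two_le (X : Matrix (Fin 2) (Fin 2) ℂ) :
    ‖(lieC (suGroupModel 2)).orthogonalProjectionOnto (vecE (suGroupModel 2).N X)‖ ≤ 2 * ‖X‖ :=
  ((lieC (suGroupModel 2)).norm_orthogonalProjectionOnto_apply_le _).trans (norm_vecE_two_le X)

end VecE

/-! ## §2 The old blocks of the canonical core polymerisation -/

section OldBlocks

variable {F : T3Family} {𝔠 : AlphaConsts F.L (suGroupModel 2).N} {γ : ℝ} {hγ : 0 < γ} {hγ1 : γ ≤ (min 𝔠.gamma0 1) ^ 2}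

/-- **BELOW THE NEW LEVEL THE LISTED DOMAINS ARE SINGLE BLOCKS**: at lattice level `k ≤ K` (trivial history), a listed domain of term level `1 ≤ i < k` of the canonical core
polymerisation is `blockSet K i y` for an old block `y`. [cite: Balaban1985UV3, (43) p.266] -/
theorem exists_blockSet_of_mem_canonLocCore (q : ∀ K, AlphaInputsT3AC.PkgCoreV3 F 𝔠 γ hγ hγ1 K) {K k i : ℕ} (hk : k ≤ K) (hik : i < k) (hi1 : 1 ≤ i)
    {Y : Set (Site (F.P K) 0)} (hY : Y ∈ canonLocCore q K k (Hist.triv (F.P K) k) i) : ∃ y : Site (F.P K) i, Y = blockSet K i y := by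
  classical
  cases k with
  | zero => omega
  | succ k' =>
    have hk' : k' + 1 ≤ K := hk
    have hi : i ≠ k' + 1 := by omega
    have hi' : i ∈ Finset.Icc 1 k' := Finset.mem_Icc.mpr ⟨hi1, by omega⟩
    simp only [canonLocCore, if_pos hk', if_neg hi, if_pos hi', Finset.mem_image] at hY
    obtain ⟨y, -, rfl⟩ := hY
    exact ⟨y, rfl⟩

end OldBlocks

/-! ## §3 The natural configuration family `B♮` and its rows: (N)'s configuration clause, (R4-low), (R4), and the I-11 row `CfgDistΦ` -/

section Natural

variable {F : T3Family} {𝔠 : AlphaConsts F.L (suGroupModel 2).N} {γ : ℝ} {hγ : 0 < γ} {hγ1 : γ ≤ (min 𝔠.gamma0 1) ^ 2}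

open Classical in
/-- **(N)'s CONFIGURATION CLAUSE FOR `B♮`**: on the new level the natural family IS the birth configuration — `B♮ K (k+1) k (domSet X) W = Bcfg_X(triv, W)` for every retained
step-`k` domain `X` (`k + 1 ≤ K`). [cite: Balaban1985UV3, (27) p.263, (60)-(61) p.271] -/
theorem natural_newLevel_eq_bcfg (p : ∀ K, AlphaInputsT3AC.PkgAtV3Chi F 𝔠 γ hγ hγ1 K) {p₁ : ℝ} (K k : ℕ) (hk : k + 1 ≤ K)
    (X : (tsys 3 (nblkOf (SK F 𝔠 γ hγ hγ1 K) 𝔠.lane.carrier k)).Dom) (hX : X ∈ newDomsCore (fun K => (p K).toCore) K k (Hist.triv (F.P K) (k + 1)))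
    (W : GaugeField (F.P K) (k + 1) (Matrix.specialUnitaryGroup (Fin 2) ℂ)) :
    (fun K k b Y W c =>
        if h : b + 1 = k then birthCfgAt (fun K => (p K).toCore) K b Y (h ▸ W) c
        else if (l1 (rel (anchors_nonempty (F := F) K b Y).choose c.src) : ℝ) *
            (2 * (𝔠.B₃ * θBal F.L γ 𝔠.b₀ p₁ (K - k)) * (((F.L : ℝ) ^ (k - b))⁻¹) ^ 2) ≤ 1 / 2 then
          (lieC (suGroupModel 2)).orthogonalProjectionOnto
            (vecE (suGroupModel 2).N
              (B27T (unitsField (toUField (Averaging.iter (fun i => BlockAveraging.blockAvg (P := F.P K) (j := i) ℰp) b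
                ((p K).UkH k (Hist.triv (F.P K) k) W)))) (anchors_nonempty (F := F) K b Y).choose c))
        else 0) K (k + 1) k (domSet (F := F) 𝔠.lane.carrier.M₁ K k X) W =
      (((p K).toCore).𝔖 k).Bcfg X (Hist.triv (F.P K) (k + 1)) W := by
  funext c
  dsimp only
  rw [dif_pos rfl]
  exact congrFun (birthCfgAt_domSet (fun K => (p K).toCore) K k (by have := F.hm; omega) X hX W) c

open Classical in
/-- **(N) `NewLevelIsBirth` HOLDS FOR THE CANONICAL TRIPLE `(birthChartCore, 0, B♮)`** (the chart and vacuum-constant clauses by `rfl`, the configuration clause by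
`natural_newLevel_eq_bcfg`). [cite: Balaban1985UV3, (33) p.264, (60)-(61) p.271] -/
theorem newLevelIsBirth_natural (p : ∀ K, AlphaInputsT3AC.PkgAtV3Chi F 𝔠 γ hγ hγ1 K) {p₁ : ℝ} :
    NewLevelIsBirth (fun K => (p K).toCore) (birthChartCore fun K => (p K).toCore) (fun _ _ _ => 0)
      (fun K k b Y W c =>
        if h : b + 1 = k then birthCfgAt (fun K => (p K).toCore) K b Y (h ▸ W) c
        else if (l1 (rel (anchors_nonempty (F := F) K b Y).choose c.src) : ℝ) *
            (2 * (𝔠.B₃ * θBal F.L γ 𝔠.b₀ p₁ (K - k)) * (((F.L : ℝ) ^ (k - b))⁻¹) ^ 2) ≤ 1 / 2 then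
          (lieC (suGroupModel 2)).orthogonalProjectionOnto
            (vecE (suGroupModel 2).N
              (B27T (unitsField (toUField (Averaging.iter (fun i => BlockAveraging.blockAvg (P := F.P K) (j := i) ℰp) b
                ((p K).UkH k (Hist.triv (F.P K) k) W)))) (anchors_nonempty (F := F) K b Y).choose c))
        else 0) := by
  intro K k hk X hX
  exact ⟨rfl, rfl, fun W => natural_newLevel_eq_bcfg p K k hk X hX W⟩

open Classical in
/-- **(R4-low) `CfgDistOwnΦLow` DISCHARGED FOR `B♮`** at the χ-datum and a free profile `p₁`: below the new level `B♮` is the `𝔤ᶜ`-projection of print's loop variable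
`(1/i) log Ū^b(U_k(triv,W))(Γ_{y,c₋} ∪ c ∪ Γ_{c₊,y})` (`y = y(Y)` a chosen anchor) on print's regime `|c₋−y|₁·2B₃θ_{p₁}(K−k)(L^{k−b})⁻² ≤ ½` and `0` outside it, and the row
holds with `C_s = 24·L·B₃` as soon as every window `θ_{b₀,p₁}(n)`, `n < K`, lies in r1's range and inside [B7] Prop. 2's letters (`hθ`).
[cite: Balaban1985UV3, (43)-(44) pp.266-267, (27)-(28) p.263; Balaban1985Variational, Thm 1 (8) p.279; Balaban1985Averaging, Prop. 2 (54) p.26] -/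
theorem cfgDistOwnΦLow_chi_natural (p : ∀ K, AlphaInputsT3AC.PkgAtV3Chi F 𝔠 γ hγ hγ1 K) {p₁ : ℝ}
    (hθ : ∀ K n, n < K →
      θBal F.L γ 𝔠.b₀ p₁ n ≤ (p K).a₁ ∧ 𝔠.B₃ * θBal F.L γ 𝔠.b₀ p₁ n ≤ (p K).a₀ ∧
      (143 * ((((3 + 4 : ℕ) : ℝ)) ^ 2 / 4) ^ 2) * (𝔠.B₃ * θBal F.L γ 𝔠.b₀ p₁ n) ≤ 1 / 3 ∧
      2 * (𝔠.B₃ * θBal F.L γ 𝔠.b₀ p₁ n) ≤ 2 * deltaSU (Fin 2) / (((3 + 4) * F.L : ℕ) : ℝ) ^ 2) :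
    CfgDistOwnΦLow (AlphaInputsT3AC.dataOfV3chi p (canonPolymerCore fun K => (p K).toCore))
      (fun K k b Y W c =>
        if h : b + 1 = k then birthCfgAt (fun K => (p K).toCore) K b Y (h ▸ W) c
        else if (l1 (rel (anchors_nonempty (F := F) K b Y).choose c.src) : ℝ) *
            (2 * (𝔠.B₃ * θBal F.L γ 𝔠.b₀ p₁ (K - k)) * (((F.L : ℝ) ^ (k - b))⁻¹) ^ 2) ≤ 1 / 2 then
          (lieC (suGroupModel 2)).orthogonalProjectionOnto
            (vecE (suGroupModel 2).N
              (B27T (unitsField (toUField (Averaging.iter (fun i => BlockAveraging.blockAvg (P := F.P K) (j := i) ℰp) b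
                ((p K).UkH k (Hist.triv (F.P K) k) W)))) (anchors_nonempty (F := F) K b Y).choose c))
        else 0)
      (canonLegDist F) 𝔠.b₀ p₁ (24 * F.L * 𝔠.B₃) := by
  intro K n hnK j hj V hV Y hY c
  have hn : n < K := by omega
  have hKn : K - (K - n) = n := by omega
  have hjne : ¬ (j + 1 = K - n) := by omega
  obtain ⟨y', rfl⟩ := exists_blockSet_of_mem_canonLocCore (fun K => (p K).toCore) (K := K) (k := K - n) (i := 1 + j) (by omega) (by omega) (by omega) hY
  set y := (anchors_nonempty (F := F) K j (blockSet K (1 + j) y')).choose with hydef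
  have hy : y ∈ anchors K j (blockSet K (1 + j) y') := (anchors_nonempty (F := F) K j (blockSet K (1 + j) y')).choose_spec
  obtain ⟨h1, h2, h3, h4⟩ := hθ K n hn
  have hγ1' : γ ≤ 1 := hγ1.trans (sq_min_one_le _ 𝔠.gamma0_pos)
  have hθpos : 0 < θBal F.L γ 𝔠.b₀ p₁ n := T3MinimiserStabilityReduction.θBal_pos F.hL.2.le hγ hγ1' 𝔠.b₀_pos p₁ n
  have hrhs : 0 ≤ 24 * (F.L : ℝ) * 𝔠.B₃ * (1 + canonLegDist F K j (blockSet K (1 + j) y') c) * θBal F.L γ 𝔠.b₀ p₁ n *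
      (((F.L : ℝ) ^ (K - n - 1 - j))⁻¹) ^ 2 := by
    have := 𝔠.B₃_pos
    have := canonLegDist_nonneg F K j (blockSet K (1 + j) y') c
    positivity
  dsimp only
  rw [dif_neg hjne, hKn]
  split_ifs with hreg
  · calc _ ≤ 2 * ‖B27T (unitsField (toUField (Averaging.iter (fun i => BlockAveraging.blockAvg (P := F.P K) (j := i) ℰp) j
            ((p K).UkH (K - n) (Hist.triv (F.P K) (K - n))
              (fieldShift (F.sitesPerDir_eq (m := F.m) (K := K) (j := K - n) (m' := F.m) (K' := n) (j' := 0) (by omega)) V))))) y c‖ :=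
          norm_proj_vecE_two_le _
      _ ≤ 2 * ((12 * (F.L : ℝ) * 𝔠.B₃) * (1 + canonLegDist F K j (blockSet K (1 + j) y') c) * θBal F.L γ 𝔠.b₀ p₁ n *
            (((F.L : ℝ) ^ (K - n - 1 - j))⁻¹) ^ 2) :=
          mul_le_mul_of_nonneg_left (norm_B27T_avg_minimiser_le_canonLegDist_window (p K).minRows hn hθpos
            h1 h2 h3 h4 V hV (show 1 + j = j + 1 by omega) (by omega) y' hy c hreg) (by norm_num)
      _ = _ := by ring
  · rw [norm_zero]
    exact hrhs

open Classical in
/-- **(R4) `CfgDistOwnΦ` FOR `B♮` AT EVERY PROFILE `p₁ ≥ p₀ + r₀`** (`cfgDistOwnΦ_chi_of_low_of_newLevelIsBirth` on (R4-low) and (N) for the canonical triple):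
constant `max (24·L·B₃) (cB·(√L)⁻¹(1 + log √L)^{p₁})`. [cite: Balaban1985UV3, (27)-(28) p.263, (44) p.267] -/
theorem cfgDistOwnΦ_chi_natural (p : ∀ K, AlphaInputsT3AC.PkgAtV3Chi F 𝔠 γ hγ hγ1 K) {p₁ : ℝ} (hp : 𝔠.p₀ + 𝔠.r₀ ≤ p₁)
    (hθ : ∀ K n, n < K →
      θBal F.L γ 𝔠.b₀ p₁ n ≤ (p K).a₁ ∧ 𝔠.B₃ * θBal F.L γ 𝔠.b₀ p₁ n ≤ (p K).a₀ ∧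
      (143 * ((((3 + 4 : ℕ) : ℝ)) ^ 2 / 4) ^ 2) * (𝔠.B₃ * θBal F.L γ 𝔠.b₀ p₁ n) ≤ 1 / 3 ∧
      2 * (𝔠.B₃ * θBal F.L γ 𝔠.b₀ p₁ n) ≤ 2 * deltaSU (Fin 2) / (((3 + 4) * F.L : ℕ) : ℝ) ^ 2) :
    CfgDistOwnΦ (AlphaInputsT3AC.dataOfV3chi p (canonPolymerCore fun K => (p K).toCore))
      (fun K k b Y W c =>
        if h : b + 1 = k then birthCfgAt (fun K => (p K).toCore) K b Y (h ▸ W) c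
        else if (l1 (rel (anchors_nonempty (F := F) K b Y).choose c.src) : ℝ) *
            (2 * (𝔠.B₃ * θBal F.L γ 𝔠.b₀ p₁ (K - k)) * (((F.L : ℝ) ^ (k - b))⁻¹) ^ 2) ≤ 1 / 2 then
          (lieC (suGroupModel 2)).orthogonalProjectionOnto
            (vecE (suGroupModel 2).N
              (B27T (unitsField (toUField (Averaging.iter (fun i => BlockAveraging.blockAvg (P := F.P K) (j := i) ℰp) b
                ((p K).UkH k (Hist.triv (F.P K) k) W)))) (anchors_nonempty (F := F) K b Y).choose c))
        else 0)
      (canonLegDist F) 𝔠.b₀ p₁ (max (24 * F.L * 𝔠.B₃) (𝔠.cB * ((Real.sqrt F.L)⁻¹ * (1 + Real.log (Real.sqrt F.L)) ^ p₁))) :=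
  cfgDistOwnΦ_chi_of_low_of_newLevelIsBirth p hp (by have := 𝔠.B₃_pos; have := F.hL.2; positivity) (newLevelIsBirth_natural p)
    (cfgDistOwnΦLow_chi_natural p hθ)

open Classical in
/-- **THE I-11 ROW (44) `CfgDistΦ` HOLDS FOR THE NATURAL CONFIGURATION FAMILY `B♮`** (both runs, canonical leg distance, every profile `p₁ ≥ p₀ + r₀`, under the window letters
`hθ`): `cfgDistΦ_of_own` on (R4) (`locMatched_canonCore`, `canonLegDist_matched`). [cite: Balaban1985UV3, (44) p.267; Balaban1987RG1, (0.1) p.251] -/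
theorem cfgDistΦ_chi_natural (p : ∀ K, AlphaInputsT3AC.PkgAtV3Chi F 𝔠 γ hγ hγ1 K) {p₁ : ℝ} (hp : 𝔠.p₀ + 𝔠.r₀ ≤ p₁)
    (hθ : ∀ K n, n < K →
      θBal F.L γ 𝔠.b₀ p₁ n ≤ (p K).a₁ ∧ 𝔠.B₃ * θBal F.L γ 𝔠.b₀ p₁ n ≤ (p K).a₀ ∧
      (143 * ((((3 + 4 : ℕ) : ℝ)) ^ 2 / 4) ^ 2) * (𝔠.B₃ * θBal F.L γ 𝔠.b₀ p₁ n) ≤ 1 / 3 ∧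
      2 * (𝔠.B₃ * θBal F.L γ 𝔠.b₀ p₁ n) ≤ 2 * deltaSU (Fin 2) / (((3 + 4) * F.L : ℕ) : ℝ) ^ 2) :
    CfgDistΦ (AlphaInputsT3AC.dataOfV3chi p (canonPolymerCore fun K => (p K).toCore))
      (fun K k b Y W c =>
        if h : b + 1 = k then birthCfgAt (fun K => (p K).toCore) K b Y (h ▸ W) c
        else if (l1 (rel (anchors_nonempty (F := F) K b Y).choose c.src) : ℝ) *
            (2 * (𝔠.B₃ * θBal F.L γ 𝔠.b₀ p₁ (K - k)) * (((F.L : ℝ) ^ (k - b))⁻¹) ^ 2) ≤ 1 / 2 then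
          (lieC (suGroupModel 2)).orthogonalProjectionOnto
            (vecE (suGroupModel 2).N
              (B27T (unitsField (toUField (Averaging.iter (fun i => BlockAveraging.blockAvg (P := F.P K) (j := i) ℰp) b
                ((p K).UkH k (Hist.triv (F.P K) k) W)))) (anchors_nonempty (F := F) K b Y).choose c))
        else 0)
      (canonLegDist F) 𝔠.b₀ p₁ (max (24 * F.L * 𝔠.B₃) (𝔠.cB * ((Real.sqrt F.L)⁻¹ * (1 + Real.log (Real.sqrt F.L)) ^ p₁))) :=
  cfgDistΦ_of_own (locMatched_canonCore fun K => (p K).toCore) (canonLegDist_matched F) (cfgDistOwnΦ_chi_natural p hp hθ)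

end Natural

end Summit.QuantumFields.YangMills.Theorems.GlobalSlackKernelLeg

end
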